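import Literature.NumberTheory.GaloisRepresentations.TateDualLimitLocalPairing
import Literature.NumberTheory.GaloisRepresentations.GaloisH1MapBijectiveUnramified
import Literature.NumberTheory.GaloisCohomology.PoitouTateSelmerStructures
import HarnessLib

/-!
# Level Selmer structures of a torsion tower `(D_k)_k` (Greenberg 2010 §3.2, proof of Prop. 3.2.1)

Topic `NumberTheory/GaloisRepresentations`; namespace
`Literature.NumberTheory.GaloisRepresentations.DiscreteGaloisModule.TorsionLayers`. ONE definition
(`levelSelmerStructure`) with its unfolding / monotonicity lemmas; no named fact, no `sorry`, no
instance. Lane «SUR-Λ» of cell `bsd-eis` (road memo `SUR-LAMBDA-ROAD-w5g9.md` §2 ★(ε), brick C6c),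
`--supports stmt-BirchSwinnertonDyer-19032`.

MATHEMATICS (R. Greenberg, *Surjectivity of the global-to-local map defining a Selmer group*,
Kyoto J. Math. 50 (2010), proof of Prop. 3.2.1, p. 15): for the finite Galois submodules
`D[𝔪ⁿ] ⊆ D` one uses the Selmer groups "for `D[𝔪ⁿ]` over `K`" cut out by THE SAME specification —
at `v ∈ Σ` the local condition on `H¹(K_v, D[𝔪ⁿ])` is the preimage of `L(K_v, D)` under
`H¹(K_v, D[𝔪ⁿ]) → H¹(K_v, D)`, and at the (finite) places outside `Σ` the unramified classes
(the Galois module being unramified there).  For a torsion tower `E : τ.TorsionLayers p`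
(`D_k = E.N k`, the tree's datum of `PontryaginTateDualInverseLimit.lean`), a Selmer structure
`𝓛` on `D` and a finite set of places `T` (= `Σ`) this file defines that level-`k` Selmer structure

* `E.levelSelmerStructure 𝓛 T k : SelmerStructure (E.layerRep k)` — at `v ∈ T` the preimage
  `((D_k ⊆ D)_*)⁻¹ (𝓛_v)` (`E.localSubtypeMap v k`, `TateDualLimitLocalPairing.lean`), at a finite
  `v ∉ T` the unramified subgroup `H¹_ur(K_v, D_k)` (and, irrelevant for the applications where
  `T` contains the archimedean places, the preimage again at an archimedean `v ∉ T`);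

and proves: the unfolding lemmas (`levelSelmerStructure_of_mem`, `mem_levelSelmerStructure_iff`,
`levelSelmerStructure_inr_of_not_mem`, `levelSelmerStructure_top_of_mem`), that it is unramified
outside `T` (`isUnramifiedOutside_levelSelmerStructure`), and that the level structures are
COMPATIBLE WITH THE LAYER INCLUSIONS `D_n ⊆ D_m` (`localInclMap_mem_levelSelmerStructure`: on `T` by
`(D_m ⊆ D)_* ∘ (D_n ⊆ D_m)_* = (D_n ⊆ D)_*`, off `T` because `H¹` of an equivariant map carries
unramified classes to unramified classes, Milne ADT I §2) — the hypothesis `h𝓕mono` of the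
Kőnig step of Prop. 3.2.1 (Summits-side `SurLambda.exists_level_obstruction_eq_zero`).

HONESTY: bookkeeping only; nothing of Greenberg's propositions or of BSD is proved here.  AI
formalisation, weaker than expert review; the statements are established only by the kernel check.

## References
* R. Greenberg, *Surjectivity of the global-to-local map defining a Selmer group*, Kyoto J. Math.
  50 (2010) 853–888, §3.2, proof of Prop. 3.2.1 (p. 15). [Greenberg2010]
* J. S. Milne, *Arithmetic Duality Theorems*, 2nd ed. (2006), Ch. I §2 (unramified cohomology).
  [MilneADT2006]
* B. Howard, *The Heegner point Kolyvagin system*, Compos. Math. 140 (2004), Def. 2.1.10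
  (Selmer structures unramified outside `Σ`). [Howard2004HeegnerKolyvagin]
-/

noncomputable section

open Function CategoryTheory NumberField IsDedekindDomain Field
open _root_.TopRep _root_.ContRepresentation _root_.ContinuousCohomology
open scoped ContRepresentation
open Literature.NumberTheory.GaloisRepresentations.DiscreteGaloisModule

namespace Literature.NumberTheory.GaloisRepresentations

namespace DiscreteGaloisModule.TorsionLayers

variable {K : Type} [Field K] [NumberField K] {D : Type} [AddCommGroup D] [TopologicalSpace D]
  [DiscreteTopology D] {τ : DiscreteGaloisModule K D} {p : ℕ} (E : τ.TorsionLayers p)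
  (𝓛 : SelmerStructure τ) (T : Finset (Place K))

open Classical in
/-- **The level-`k` Selmer structure of the tower `(D_k)_k` cut out by `𝓛` on `T`**: at `v ∈ T` the
preimage of `𝓛_v ≤ H¹(K_v, D)` under `(D_k ⊆ D)_* : H¹(K_v, D_k) → H¹(K_v, D)`, at a finite place
`v ∉ T` the unramified classes `H¹_ur(K_v, D_k)` (Greenberg: the Selmer group "for `D[𝔪ⁿ]` over `K`"
of the same specification, `D[𝔪ⁿ]` being unramified outside `Σ`).
[cite: Greenberg2010, §3.2, proof of Prop. 3.2.1 (p. 15)]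
[cite: Howard2004HeegnerKolyvagin, Def. 2.1.10 (arXiv:1202.6340 p. 6)] -/
def levelSelmerStructure (k : ℕ) : SelmerStructure (E.layerRep k) := fun v =>
  if v ∈ T then (𝓛 v).comap (E.localSubtypeMap v k)
  else
    match v with
    | Sum.inl w => (𝓛 (Sum.inl w)).comap (E.localSubtypeMap (Sum.inl w) k)
    | Sum.inr w => unramifiedSubgroup (GaloisRep.toLocal w (E.layerRep k)) 1

variable {T}

/-- On `T` the level condition is the preimage of `𝓛_v`. [cite: Greenberg2010, §3.2, proof of Prop. 3.2.1 (p. 15)] -/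
theorem levelSelmerStructure_of_mem (k : ℕ) {v : Place K} (hv : v ∈ T) :
    E.levelSelmerStructure 𝓛 T k v = (𝓛 v).comap (E.localSubtypeMap v k) := by
  classical
  exact if_pos hv

/-- Membership on `T`: `z ∈ 𝓕_k(v) ↔ (D_k ⊆ D)_* z ∈ 𝓛_v`. [cite: Greenberg2010, §3.2, proof of Prop. 3.2.1 (p. 15)] -/
theorem mem_levelSelmerStructure_iff (k : ℕ) {v : Place K} (hv : v ∈ T)
    (z : galoisCohomology ((E.layerRep k).toLocal v) 1) :
    z ∈ E.levelSelmerStructure 𝓛 T k v ↔ E.localSubtypeMap v k z ∈ 𝓛 v := by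
  rw [levelSelmerStructure_of_mem E 𝓛 k hv]
  rfl

/-- At a finite place outside `T` the level condition is the unramified one.
[cite: Greenberg2010, §3.2, proof of Prop. 3.2.1 (p. 15)] [cite: Howard2004HeegnerKolyvagin, Def. 2.1.10 (arXiv:1202.6340 p. 6)] -/
theorem levelSelmerStructure_inr_of_not_mem (k : ℕ) {w : HeightOneSpectrum (𝓞 K)}
    (hw : (Sum.inr w : Place K) ∉ T) :
    E.levelSelmerStructure 𝓛 T k (Sum.inr w) = unramifiedSubgroup (GaloisRep.toLocal w (E.layerRep k)) 1 := by
  classical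
  exact if_neg hw

/-- The level structures are unramified outside `T` (when `T` contains the archimedean places).
[cite: Howard2004HeegnerKolyvagin, Def. 2.1.10 (arXiv:1202.6340 p. 6)] -/
theorem isUnramifiedOutside_levelSelmerStructure (hT : ∀ w : InfinitePlace K, (Sum.inl w : Place K) ∈ T)
    (k : ℕ) : (E.levelSelmerStructure 𝓛 T k).IsUnramifiedOutside T :=
  ⟨hT, fun _ hw => E.levelSelmerStructure_inr_of_not_mem 𝓛 k hw⟩

/-- For the relaxed structure `𝓛 = ⊤` the level condition on `T` is everything.
[cite: Greenberg2010, §3.2, proof of Prop. 3.2.1 (p. 15)] -/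
theorem levelSelmerStructure_top_of_mem (k : ℕ) {v : Place K} (hv : v ∈ T) :
    E.levelSelmerStructure ⊤ T k v = ⊤ := by
  rw [levelSelmerStructure_of_mem E ⊤ k hv]
  exact AddSubgroup.comap_top _

/-- `𝓛 ≤ 𝓛'` gives `𝓕_k(𝓛) ≤ 𝓕_k(𝓛')` at every level. [cite: Greenberg2010, §3.2, proof of Prop. 3.2.1 (p. 15)] -/
theorem levelSelmerStructure_mono (k : ℕ) {𝓛 𝓛' : SelmerStructure τ} (h : 𝓛 ≤ 𝓛') :
    E.levelSelmerStructure 𝓛 T k ≤ E.levelSelmerStructure 𝓛' T k := by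
  classical
  intro v
  by_cases hv : v ∈ T
  · rw [levelSelmerStructure_of_mem E 𝓛 k hv, levelSelmerStructure_of_mem E 𝓛' k hv]
    exact AddSubgroup.comap_mono (h v)
  · cases v with
    | inl w =>
      change (if (Sum.inl w : Place K) ∈ T then _ else (𝓛 (Sum.inl w)).comap _) ≤
        (if (Sum.inl w : Place K) ∈ T then _ else (𝓛' (Sum.inl w)).comap _)
      rw [if_neg hv, if_neg hv]
      exact AddSubgroup.comap_mono (h _)
    | inr w =>
      rw [levelSelmerStructure_inr_of_not_mem E 𝓛 k hv, levelSelmerStructure_inr_of_not_mem E 𝓛' k hv]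

/-- **Compatibility with the layer inclusions** (`n ≤ m`): `(D_n ⊆ D_m)_*` carries `𝓕_n(v)` into
`𝓕_m(v)` at every place — on `T` since `(D_m ⊆ D)_* ∘ (D_n ⊆ D_m)_* = (D_n ⊆ D)_*`, at a finite
`v ∉ T` since `H¹` of an equivariant map preserves unramified classes (Milne I §2).  This is the
hypothesis `h𝓕mono` of the Kőnig step of Prop. 3.2.1.
[cite: Greenberg2010, §3.2, proof of Prop. 3.2.1 (p. 15)] [cite: MilneADT2006, Ch. I §2] -/
theorem localInclMap_mem_levelSelmerStructure (hT : ∀ w : InfinitePlace K, (Sum.inl w : Place K) ∈ T)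
    {n m : ℕ} (h : n ≤ m) (v : Place K) {z : galoisCohomology ((E.layerRep n).toLocal v) 1}
    (hz : z ∈ E.levelSelmerStructure 𝓛 T n v) :
    E.localInclMap v h z ∈ E.levelSelmerStructure 𝓛 T m v := by
  by_cases hv : v ∈ T
  · rw [mem_levelSelmerStructure_iff E 𝓛 _ hv] at hz ⊢
    rwa [localSubtypeMap_localInclMap]
  · cases v with
    | inl w => exact absurd (hT w) hv
    | inr w =>
      rw [levelSelmerStructure_inr_of_not_mem E 𝓛 _ hv] at hz ⊢
      exact galoisCohomology.map_unramifiedSubgroup_le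
        (τ := GaloisRep.toLocal w (E.layerRep n)) (τ' := GaloisRep.toLocal w (E.layerRep m))
        ((E.layerInclHom h).hom.restrictField (Place.Completion (Sum.inr w : Place K))) ⟨z, hz, rfl⟩

/-- The same compatibility, with the push-forward written as the tree's `galoisCohomology.map` of
the restricted layer inclusion (the spelling of `SurLambda.exists_level_obstruction_eq_zero`).
[cite: Greenberg2010, §3.2, proof of Prop. 3.2.1 (p. 15)] -/
theorem map_layerInclHom_mem_levelSelmerStructure
    (hT : ∀ w : InfinitePlace K, (Sum.inl w : Place K) ∈ T) ⦃n m : ℕ⦄ (h : n ≤ m) (v : Place K)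
    (z : galoisCohomology ((E.layerRep n).toLocal v) 1) (hz : z ∈ E.levelSelmerStructure 𝓛 T n v) :
    galoisCohomology.map ((E.layerInclHom h).hom.restrictField (Place.Completion v)) 1 z ∈
      E.levelSelmerStructure 𝓛 T m v :=
  E.localInclMap_mem_levelSelmerStructure 𝓛 hT h v hz

end DiscreteGaloisModule.TorsionLayers

end Literature.NumberTheory.GaloisRepresentations
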